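import Summits.BirchSwinnertonDyer.BirchSwinnertonDyer.Theorems.ManinLocalTwoThreePrimeClassGenerationThreeMatrices
import HarnessLib

/-!
# Route `ManinLocalTwoThree`, crux C3 `ManinPrimeToThreeAtNine` (stmt-BirchSwinnertonDyer-22968), line `kato-shift-three`
# (es g6): PRIME-CLASS GENERATION OVER LEGENDRE-ADMISSIBLE PRIMES — for `9 ∣ N` and any prescribed Jacobi signs
# `ε_q = ±1` at the primes `q ∥ N`, the prime classes `{0, a/ℓ}_f` over the primes `ℓ ≥ ℓ₀`, `ℓ ∤ N`,
# `ℓ ≡ 11 (mod 12)`, `(q/ℓ) = ε_q` (all `q ∥ N`) generate a subgroup of `Λ_f` containing `2Λ_f`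
# (line prover p3; helper, unconditional; the `p = 3` twin of `…PrimeClassGeneration`; part 2/2, part 1 =
# `…PrimeClassGenerationThreeMatrices`)

This is the classical half of the generation law E-es-19 `ShiftClassGenerationThree` (leaf `KatoShiftThreeLaws`; its
index set `{ℓ | ℓ₀ ≤ ℓ ∧ AdmissiblePrime W N ℓ}` is the instance `ε = epsSign W`), and it is candidate E-es-15
(`PrimeDenominatorGeneration`, «the prime classes over admissible primes generate a subgroup of 2-power index») in the
sharp form INDEX ≤ 2.  Everything is `W`-free and route-independent.

Mechanism.  `γ ↦ u(γ) = {∞, γ∞}_f` is a homomorphism `Γ₀(N) → Λ_f` onto `Λ_f` (Manin), and the admissibility of a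
Dirichlet prime `ℓ ≡ d_γ (mod N)` realising `u(γ)` (`…PrimeClassGeneration`) is a condition on the class of `d_γ`:
`d ≡ 2 (mod 3)`, `d ≡ 3 (mod 4)` if `4 ∣ N`, and `(d/q) = ±ε_q` at the odd `q ∥ N` (quadratic reciprocity at
`ℓ ≡ 3 (mod 4)`); the conditions at `2` when `4 ∤ N` (`ℓ ≡ 3 (mod 4)`, and `(2/ℓ) = ε₂` if `2 ∥ N`) are imposed
freely by steering `ℓ mod 8` (parabolic modification `d ↦ d + Nkb` with `b` odd, then `b ↦ b(1 − d²) + 8d ∈ 8ℤ`).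
These conditions are quadratic: they hold for `d₀·d²` whenever they hold for `d₀`.  Hence for EVERY `γ`,
`2u(γ) = u(γ₀γγ) − u(γ₀)` with both `γ₀γγ` and `γ₀` admissible, once ONE admissible `γ₀ ∈ Γ₀(N)` exists — which the
Chinese remainder theorem and a quadratic non-residue at each odd `q ∥ N` provide.

* `cuspSymbol_mem_closure_primeClass_admissibleThree` — an admissible `γ` has its period among the prime classes at
  admissible primes `ℓ > n₀` (part 1 supplies `exists_gamma0_transMul`, `exists_prime_eq_cuspSymbol`, the arithmetic);
* `two_mul_mem_closure_primeClass_admissibleThree` — **`2Λ_f ⊆ ⟨{0, a/ℓ}_f : ℓ ≥ ℓ₀ admissible⟩`** (with part 1's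
  `exists_gamma0_admissibleThree`).

Nothing about BSD is proved here; Manin's conjecture at `3` is NOT proved here; E-es-19 is NOT proved here.
-/

set_option autoImplicit false
set_option linter.dupNamespace false

noncomputable section

open scoped Classical MatrixGroups ModularForm

open CongruenceSubgroup Matrix.SpecialLinearGroup ModularGroup
  Literature.NumberTheory.EllipticCurves Literature.NumberTheory.EllipticCurves.ModularForms

namespace Summit.BirchSwinnertonDyer.BirchSwinnertonDyer.Theorems.ManinLocalTwoThree



/-! ### An admissible matrix has its period among the prime classes at admissible primes -/

section Admissible

variable {N : ℕ} [NeZero N] (f : CuspForm (Gamma0 N) 2)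

/-- **Per-matrix admissible realisation.** Let `3 ∣ N`, let `ε_q = ±1` be prescribed signs, and let
`γ = (a b; c d) ∈ Γ₀(N)` have an ADMISSIBLE `d`-class: `d ≡ 2 (mod 3)`, `d ≡ 3 (mod 4)` if `4 ∣ N`, and
`(d/q) = ε_q` resp. `−ε_q` at the odd `q ∥ N` with `q ≡ 1` resp. `3 (mod 4)`. Then for every `n₀` the period
`{∞, γ∞}_f` is a prime class `{0, a'/ℓ}_f` at a prime `ℓ > n₀`, `ℓ ∤ N`, `ℓ ≡ 11 (mod 12)`, `(q/ℓ) = ε_q` for all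
`q ∥ N` (including `q = 2` when `2 ∥ N`). Steps: make `b` odd (`T`), steer `d mod 8` by `(1 0; Nk 1)` when `4 ∤ N`,
make `8 ∣ b` (`T^{8 − bd}`), take a Dirichlet prime `ℓ = d + Nkb` (`exists_prime_eq_cuspSymbol`), and read the
Jacobi symbols off `ℓ ≡ d (mod 8N)` by quadratic reciprocity (`jacobiSym.quadratic_reciprocity_one_mod_four`,
`…_three_mod_four`, `jacobiSym.at_two`). [folklore] -/
theorem cuspSymbol_mem_closure_primeClass_admissibleThree (ε : ℕ → ℤ) (hε : ∀ q, ε q = 1 ∨ ε q = -1)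
    (h3 : 3 ∣ N) (γ : Gamma0 N) (n₀ : ℕ)
    (hd3 : ((γ : SL(2, ℤ)) 1 1 : ℤ) % 3 = 2)
    (hd4 : 4 ∣ N → ((γ : SL(2, ℤ)) 1 1 : ℤ) % 4 = 3)
    (hdq : ∀ q ∈ N.primeFactors, q ≠ 2 → ¬ q ^ 2 ∣ N →
      jacobiSym ((γ : SL(2, ℤ)) 1 1 : ℤ) q = if q % 4 = 1 then ε q else -ε q) :
    cuspSymbol f γ ∈ AddSubgroup.closure
      {z : ℂ | ∃ ℓ : ℕ, ℓ.Prime ∧ n₀ < ℓ ∧ ¬ ℓ ∣ N ∧ ℓ % 12 = 11 ∧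
        (∀ q ∈ N.primeFactors, ¬ q ^ 2 ∣ N → jacobiSym (q : ℤ) ℓ = ε q) ∧
        ∃ a : ℕ, 0 < a ∧ a < ℓ ∧ z = modularSymbol f ((a : ℚ) / ℓ) - modularSymbol f 0} := by
  have hN0 : 0 < N := Nat.pos_of_ne_zero (NeZero.ne N)
  set d : ℤ := (γ : SL(2, ℤ)) 1 1 with hd
  -- two small facts about units of `ℤ`
  have two_not_unit : ¬ IsUnit (2 : ℤ) := by
    intro h; rcases Int.isUnit_iff.mp h with h | h <;> norm_num at h
  have three_not_unit : ¬ IsUnit (3 : ℤ) := by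
    intro h; rcases Int.isUnit_iff.mp h with h | h <;> norm_num at h
  -- Step A: make `b` odd (and keep `d`)
  obtain ⟨γ₁, hd₁, hb₁, hγ₁⟩ : ∃ γ₁ : Gamma0 N, ((γ₁ : SL(2, ℤ)) 1 1 : ℤ) = d ∧
      ((γ₁ : SL(2, ℤ)) 0 1 : ℤ) % 2 = 1 ∧ cuspSymbol f γ₁ = cuspSymbol f γ := by
    by_cases hbodd : ((γ : SL(2, ℤ)) 0 1 : ℤ) % 2 = 1
    · exact ⟨γ, rfl, hbodd, rfl⟩
    · obtain ⟨γ₁, h01, h11, hγ₁⟩ := exists_gamma0_transMul f γ 1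
      have hdodd : d % 2 = 1 := by
        by_contra hd2
        have h2b : (2 : ℤ) ∣ ((γ : SL(2, ℤ)) 0 1 : ℤ) := by omega
        have h2d : (2 : ℤ) ∣ d := by omega
        exact two_not_unit ((isCoprime_apply_zero_one_apply_one_one γ).isUnit_of_dvd' h2b h2d)
      refine ⟨γ₁, h11, ?_, hγ₁⟩
      rw [h01, ← hd]
      omega
  -- the target residue mod 8 (only used when `4 ∤ N`): `χ₈(r) = ε 2`, `r ≡ 3 (mod 4)`
  obtain ⟨r, hr, hrε⟩ : ∃ r : ℤ, (r = 7 ∨ r = 3) ∧ (r = 7 ↔ ε 2 = 1) := by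
    rcases hε 2 with h | h
    · exact ⟨7, Or.inl rfl, by simp [h]⟩
    · exact ⟨3, Or.inr rfl, by constructor <;> intro h' <;> simp_all⟩
  -- Step B: steer `d mod 8` when `4 ∤ N` (keeping `d mod N` and `b`)
  obtain ⟨γ₂, hd₂N, hb₂, hd₂4, hd₂8, hγ₂⟩ : ∃ γ₂ : Gamma0 N, ((γ₂ : SL(2, ℤ)) 1 1 : ℤ) ≡ d [ZMOD N] ∧
      ((γ₂ : SL(2, ℤ)) 0 1 : ℤ) % 2 = 1 ∧ ((γ₂ : SL(2, ℤ)) 1 1 : ℤ) % 4 = 3 ∧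
      (¬ 4 ∣ N → ((γ₂ : SL(2, ℤ)) 1 1 : ℤ) % 8 = r) ∧ cuspSymbol f γ₂ = cuspSymbol f γ := by
    by_cases h4 : 4 ∣ N
    · exact ⟨γ₁, by rw [hd₁], hb₁, by rw [hd₁]; exact hd4 h4, fun h => absurd h4 h, hγ₁⟩
    · set b₁ : ℤ := (γ₁ : SL(2, ℤ)) 0 1 with hb₁def
      -- `d` and `r` have the same parity as soon as `2 ∣ N`; find `k` with `d + N k b₁ ≡ r (mod 8)`
      obtain ⟨k, hk⟩ : ∃ k : ℤ, (d + N * k * b₁) % 8 = r := by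
        have hr8 : r % 8 = r := by rcases hr with rfl | rfl <;> norm_num
        by_cases h2 : 2 ∣ N
        · obtain ⟨N', hN'⟩ := h2
          have hN'odd : (N' : ℤ) % 2 = 1 := by
            have : ¬ 2 ∣ N' := fun ⟨m, hm⟩ => h4 ⟨m, by rw [hN', hm]; ring⟩
            have : N' % 2 = 1 := Nat.two_dvd_ne_zero.mp this
            exact_mod_cast congrArg (Nat.cast : ℕ → ℤ) this
          have hdodd : d % 2 = 1 := by
            by_contra hd2
            have h2d : (2 : ℤ) ∣ d := by omega
            have h2N : (2 : ℤ) ∣ (N : ℤ) := ⟨N', by rw [hN']; push_cast; ring⟩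
            exact two_not_unit ((isCoprime_apply_one_one_level γ).isUnit_of_dvd' h2d h2N)
          set g : ℤ := N' * b₁ with hg
          have hgodd : g % 2 = 1 := by
            rw [hg, Int.mul_emod, hN'odd, hb₁]
            norm_num
          obtain ⟨t, ht⟩ := exists_sq_eq_eight_mul_add_one hgodd
          obtain ⟨m, hm⟩ : ∃ m : ℤ, r - d = 2 * m := ⟨(r - d) / 2, by omega⟩
          refine ⟨g * m, ?_⟩
          have : d + (N : ℤ) * (g * m) * b₁ = r + 8 * (2 * m * t) := by
            rw [hN']
            push_cast
            linear_combination (2 * m) * ht - hm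
          rw [this, Int.add_mul_emod_self_left, hr8]
        · have hNodd : (N : ℤ) % 2 = 1 := by
            have : N % 2 = 1 := Nat.two_dvd_ne_zero.mp h2
            exact_mod_cast congrArg (Nat.cast : ℕ → ℤ) this
          set g : ℤ := N * b₁ with hg
          have hgodd : g % 2 = 1 := by
            rw [hg, Int.mul_emod, hNodd, hb₁]
            norm_num
          obtain ⟨t, ht⟩ := exists_sq_eq_eight_mul_add_one hgodd
          refine ⟨g * (r - d), ?_⟩
          have : d + (N : ℤ) * (g * (r - d)) * b₁ = r + 8 * (t * (r - d)) := by
            linear_combination (r - d) * ht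
          rw [this, Int.add_mul_emod_self_left, hr8]
      obtain ⟨γ₂, h01₂, h11₂, hγ₂⟩ := exists_gamma0_lowerMul f γ₁ k
      rw [hd₁, ← hb₁def] at h11₂
      rw [← hb₁def] at h01₂
      refine ⟨γ₂, ?_, ?_, ?_, ?_, ?_⟩
      · rw [h11₂]
        exact Int.modEq_iff_dvd.mpr ⟨-(k * b₁), by ring⟩
      · rw [h01₂]
        exact hb₁
      · rw [h11₂]
        omega
      · intro _
        rw [h11₂]
        exact hk
      · rw [hγ₂, hγ₁]
  set b₂ : ℤ := (γ₂ : SL(2, ℤ)) 0 1 with hb₂def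
  set d₂ : ℤ := (γ₂ : SL(2, ℤ)) 1 1 with hd₂def
  have hd₂odd : d₂ % 2 = 1 := by omega
  -- Step C: make `8 ∣ b` (and keep `d₂`): `b₃ = b₂ + (8 − b₂ d₂) d₂ = 8 d₂ − 8 b₂ t`
  obtain ⟨γ₃, h01₃, h11₃, hγ₃⟩ := exists_gamma0_transMul f γ₂ (8 - b₂ * d₂)
  rw [← hb₂def, ← hd₂def] at h01₃
  rw [← hd₂def] at h11₃
  obtain ⟨t, ht⟩ := exists_sq_eq_eight_mul_add_one hd₂odd
  have h8 : (8 : ℤ) ∣ ((γ₃ : SL(2, ℤ)) 0 1 : ℤ) :=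
    ⟨d₂ - b₂ * t, by rw [h01₃]; linear_combination (-b₂) * ht⟩
  have hb₃0 : ((γ₃ : SL(2, ℤ)) 0 1 : ℤ) ≠ 0 := by
    intro h0
    have hcop := isCoprime_apply_zero_one_apply_one_one γ₃
    rw [h0, h11₃, isCoprime_zero_left] at hcop
    rcases Int.isUnit_iff.mp hcop with h1 | h1
    · rw [h01₃, h1] at h0
      omega
    · rw [h01₃, h1] at h0
      omega
  -- Step D: a Dirichlet prime `ℓ = d₂ + N k' b₃ > max n₀ N`
  obtain ⟨ℓ, hℓp, hℓn, ⟨k', hk'⟩, a, ha0, ha, hper⟩ :=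
    exists_prime_eq_cuspSymbol f γ₃ hb₃0 (max n₀ N)
  rw [h11₃] at hk'
  obtain ⟨b₃', hb₃'⟩ := h8
  rw [hb₃'] at hk'
  -- hk' : ℓ = d₂ + N k' (8 b₃')
  have hℓ8 : (ℓ : ℤ) % 8 = d₂ % 8 := by
    have : (ℓ : ℤ) = d₂ + 8 * (N * k' * b₃') := by rw [hk']; ring
    rw [this, Int.add_mul_emod_self_left]
  have hℓN : (ℓ : ℤ) ≡ d [ZMOD N] := by
    have : (ℓ : ℤ) ≡ d₂ [ZMOD N] := Int.modEq_iff_dvd.mpr ⟨-(k' * (8 * b₃')), by rw [hk']; ring⟩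
    exact this.trans hd₂N
  have hℓ4 : ℓ % 4 = 3 := by
    have : (ℓ : ℤ) % 4 = 3 := by omega
    omega
  have hℓ3 : ℓ % 3 = 2 := by
    have h := hℓN.of_dvd (by exact_mod_cast h3 : (3 : ℤ) ∣ (N : ℤ))
    have : (ℓ : ℤ) % 3 = d % 3 := h
    omega
  have hℓ12 : ℓ % 12 = 11 := by omega
  have hℓgt : N < ℓ := lt_of_le_of_lt (le_max_right _ _) hℓn
  have hℓNdvd : ¬ ℓ ∣ N := fun h => absurd (Nat.le_of_dvd hN0 h) (not_le.mpr hℓgt)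
  have hℓodd : Odd ℓ := Nat.odd_iff.mpr (by omega)
  -- the Jacobi symbols
  have hJ : ∀ q ∈ N.primeFactors, ¬ q ^ 2 ∣ N → jacobiSym (q : ℤ) ℓ = ε q := by
    intro q hq hq2N
    have hqp : q.Prime := Nat.prime_of_mem_primeFactors hq
    have hqN : q ∣ N := Nat.dvd_of_mem_primeFactors hq
    by_cases hq2 : q = 2
    · subst hq2
      have h4 : ¬ 4 ∣ N := fun h => hq2N (by norm_num; exact h)
      have hd₂r : d₂ % 8 = r := hd₂8 h4
      rw [Nat.cast_ofNat, jacobiSym.at_two hℓodd, ZMod.χ₈_nat_eq_if_mod_eight]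
      have hℓ8' : ((ℓ % 8 : ℕ) : ℤ) = r := by push_cast; omega
      rcases hε 2 with h1 | h1
      · have hr7 : r = 7 := hrε.mpr h1
        have : ℓ % 8 = 7 := by omega
        rw [if_neg (by omega), if_pos (Or.inr this), h1]
      · have hr3 : r = 3 := by
          rcases hr with h | h
          · exact absurd (hrε.mp h) (by rw [h1]; norm_num)
          · exact h
        have : ℓ % 8 = 3 := by omega
        rw [if_neg (by omega), if_neg (by omega), h1]
    · have hqodd : q % 2 = 1 := by
        rcases hqp.eq_two_or_odd with h | h
        · exact absurd h hq2
        · exact h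
      have hℓq : (ℓ : ℤ) % q = d % q := hℓN.of_dvd (Int.natCast_dvd_natCast.mpr hqN)
      have hJℓ : jacobiSym (ℓ : ℤ) q = jacobiSym d q := jacobiSym.mod_left' hℓq
      have hdq' := hdq q hq hq2 hq2N
      have hq4 : q % 4 = 1 ∨ q % 4 = 3 := by omega
      rcases hq4 with hq1 | hq3
      · rw [jacobiSym.quadratic_reciprocity_one_mod_four hq1 hℓodd, hJℓ, hdq', if_pos hq1]
      · rw [jacobiSym.quadratic_reciprocity_three_mod_four hq3 hℓ4, hJℓ, hdq', if_neg (by omega),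
          neg_neg]
  rw [← hγ₂, ← hγ₃, hper]
  exact AddSubgroup.subset_closure
    ⟨ℓ, hℓp, lt_of_le_of_lt (le_max_left _ _) hℓn, hℓNdvd, hℓ12, hJ, a, ha0, ha, rfl⟩

end Admissible

/-! ### `2Λ_f` lies in the span of the prime classes over admissible primes -/

section Main

variable {N : ℕ} [NeZero N] (f : CuspForm (Gamma0 N) 2)

/-- **PRIME-CLASS GENERATION OVER LEGENDRE-ADMISSIBLE PRIMES (index ≤ 2).** Let `9 ∣ N` and let `ε_q = ±1`
be any prescribed signs. For every `ℓ₀` and every period `z ∈ Λ_f`, `2z` lies in the subgroup of `ℂ` generated by the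
prime classes `{0, a/ℓ}_f = {∞, a/ℓ}_f − {∞, 0}_f` over the primes `ℓ ≥ ℓ₀` with `ℓ ∤ N`, `ℓ ≡ 11 (mod 12)` and
`(q/ℓ) = ε_q` for every prime `q ∥ N`, `0 < a < ℓ`. (With `ε = epsSign W` the index set is E-es-19's
`{ℓ | ℓ₀ ≤ ℓ ∧ AdmissiblePrime W N ℓ}`.) Proof: `2·{∞, γ∞} = {∞, (γ₀γγ)∞} − {∞, γ₀∞}` for an admissible `γ₀`
(`exists_gamma0_admissibleThree`); admissibility is a quadratic condition on `d mod N`, so `γ₀γγ` (`d ≡ d₀d² mod N`)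
is admissible too; conclude by `cuspSymbol_mem_closure_primeClass_admissibleThree`. [folklore] -/
theorem two_mul_mem_closure_primeClass_admissibleThree (ε : ℕ → ℤ) (hε : ∀ q, ε q = 1 ∨ ε q = -1)
    (h9 : 9 ∣ N) (ℓ₀ : ℕ) {z : ℂ} (hz : z ∈ periodLattice f) :
    2 * z ∈ AddSubgroup.closure
      {z : ℂ | ∃ ℓ ∈ {ℓ : ℕ | ℓ₀ ≤ ℓ ∧ (ℓ.Prime ∧ ¬ ℓ ∣ N ∧ ℓ % 12 = 11 ∧
          ∀ q ∈ N.primeFactors, ¬ q ^ 2 ∣ N → jacobiSym (q : ℤ) ℓ = ε q)},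
        ∃ a : ℕ, 0 < a ∧ a < ℓ ∧ z = modularSymbol f ((a : ℚ) / ℓ) - modularSymbol f 0} := by
  set K : AddSubgroup ℂ := AddSubgroup.closure
      {z : ℂ | ∃ ℓ ∈ {ℓ : ℕ | ℓ₀ ≤ ℓ ∧ (ℓ.Prime ∧ ¬ ℓ ∣ N ∧ ℓ % 12 = 11 ∧
          ∀ q ∈ N.primeFactors, ¬ q ^ 2 ∣ N → jacobiSym (q : ℤ) ℓ = ε q)},
        ∃ a : ℕ, 0 < a ∧ a < ℓ ∧ z = modularSymbol f ((a : ℚ) / ℓ) - modularSymbol f 0} with hK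
  have h3 : 3 ∣ N := dvd_trans (by norm_num) h9
  have three_not_unit : ¬ IsUnit (3 : ℤ) := by
    intro h; rcases Int.isUnit_iff.mp h with h | h <;> norm_num at h
  have two_not_unit : ¬ IsUnit (2 : ℤ) := by
    intro h; rcases Int.isUnit_iff.mp h with h | h <;> norm_num at h
  obtain ⟨γ₀, h0₃, h0₄, h0q⟩ := exists_gamma0_admissibleThree (N := N) ε hε h9
  -- an admissible matrix has its period in `K`
  have hadm : ∀ δ : Gamma0 N, ((δ : SL(2, ℤ)) 1 1 : ℤ) % 3 = 2 →
      (4 ∣ N → ((δ : SL(2, ℤ)) 1 1 : ℤ) % 4 = 3) →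
      (∀ q ∈ N.primeFactors, q ≠ 2 → ¬ q ^ 2 ∣ N →
        jacobiSym ((δ : SL(2, ℤ)) 1 1 : ℤ) q = if q % 4 = 1 then ε q else -ε q) →
      cuspSymbol f δ ∈ K := by
    intro δ h₁ h₂ h₃
    refine AddSubgroup.closure_mono ?_
      (cuspSymbol_mem_closure_primeClass_admissibleThree f ε hε h3 δ ℓ₀ h₁ h₂ h₃)
    rintro w ⟨ℓ, hℓp, hℓn, hℓN, hℓ12, hℓq, a, ha0, ha, rfl⟩
    exact ⟨ℓ, ⟨hℓn.le, hℓp, hℓN, hℓ12, hℓq⟩, a, ha0, ha, rfl⟩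
  -- reduce to the generators `{∞, γ∞}`
  suffices h : periodLattice f ≤ K.comap (AddMonoidHom.mulLeft (2 : ℂ)) by
    have := h hz
    rw [AddSubgroup.mem_comap, AddMonoidHom.coe_mulLeft] at this
    exact this
  rw [periodLattice, AddSubgroup.closure_le]
  rintro _ ⟨γ, rfl⟩
  rw [SetLike.mem_coe, AddSubgroup.mem_comap, AddMonoidHom.coe_mulLeft]
  have hmul : 2 * cuspSymbol f γ = cuspSymbol f (γ₀ * γ * γ) - cuspSymbol f γ₀ := by
    rw [cuspSymbol_mul_holds f (γ₀ * γ) γ, cuspSymbol_mul_holds f γ₀ γ]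
    ring
  rw [hmul]
  refine K.sub_mem (hadm _ ?_ ?_ ?_) (hadm γ₀ h0₃ h0₄ h0q)
  all_goals
    set d : ℤ := (γ : SL(2, ℤ)) 1 1 with hd
    set d₀ : ℤ := (γ₀ : SL(2, ℤ)) 1 1 with hd₀
    have hD : (((γ₀ * γ * γ : Gamma0 N) : SL(2, ℤ)) 1 1 : ℤ) ≡ d₀ * (d * d) [ZMOD N] := by
      have h1 := gamma0_mul_apply_one_one_modEq (γ₀ * γ) γ
      have h2 := gamma0_mul_apply_one_one_modEq γ₀ γ
      have h3' := h2.mul_right d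
      rw [← hd, ← hd₀] at *
      exact h1.trans (by simpa [mul_assoc] using h3')
    have hcopN : IsCoprime d (N : ℤ) := isCoprime_apply_one_one_level γ
  · -- mod 3
    have h := hD.of_dvd (by exact_mod_cast h3 : (3 : ℤ) ∣ (N : ℤ))
    have hd3 : d % 3 ≠ 0 := by
      intro h0
      exact three_not_unit (hcopN.isUnit_of_dvd' (Int.dvd_of_emod_eq_zero h0) (by exact_mod_cast h3))
    have : (((γ₀ * γ * γ : Gamma0 N) : SL(2, ℤ)) 1 1 : ℤ) % 3 = d₀ * (d * d) % 3 := h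
    rw [this, Int.mul_emod, mul_self_emod_three hd3, h0₃]
    norm_num
  · -- mod 4
    intro h4
    have h := hD.of_dvd (by exact_mod_cast h4 : (4 : ℤ) ∣ (N : ℤ))
    have hd2 : d % 2 = 1 := by
      by_contra h0
      have h2d : (2 : ℤ) ∣ d := by omega
      have h2N : (2 : ℤ) ∣ (N : ℤ) := dvd_trans (by norm_num) (by exact_mod_cast h4 : (4 : ℤ) ∣ (N : ℤ))
      exact two_not_unit (hcopN.isUnit_of_dvd' h2d h2N)
    have : (((γ₀ * γ * γ : Gamma0 N) : SL(2, ℤ)) 1 1 : ℤ) % 4 = d₀ * (d * d) % 4 := h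
    rw [this, Int.mul_emod, mul_self_emod_four hd2, h0₄ h4]
    norm_num
  · -- Jacobi symbols at the odd `q ∥ N`
    intro q hq hq2 hq2N
    have hqP := Nat.prime_of_mem_primeFactors hq
    have hqN : q ∣ N := Nat.dvd_of_mem_primeFactors hq
    have h := hD.of_dvd (Int.natCast_dvd_natCast.mpr hqN)
    rw [jacobiSym.mod_left' h, jacobiSym.mul_left, jacobiSym.mul_left, h0q q hq hq2 hq2N]
    have hcopq : IsCoprime d (q : ℤ) := by
      obtain ⟨m, hm⟩ := hqN
      have : IsCoprime d ((q : ℤ) * (m : ℤ)) := by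
        have e : (N : ℤ) = (q : ℤ) * (m : ℤ) := by rw [hm]; push_cast; ring
        rw [← e]; exact hcopN
      exact this.of_mul_right_left
    have hgcd : d.gcd q = 1 := Int.isCoprime_iff_gcd_eq_one.mp hcopq
    rcases jacobiSym.eq_one_or_neg_one hgcd with h1 | h1 <;> rw [h1] <;> ring

end Main
end Summit.BirchSwinnertonDyer.BirchSwinnertonDyer.Theorems.ManinLocalTwoThree

end
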